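import Summits.CriticalPhenomena.SAWScalingLimit.Theses.SAWConfRestriction
import Literature.Probability.RandomPlanarGeometry.SAWScalingLimitFamily
import Literature.Probability.RandomPlanarGeometry.RestrictionPullback
import Literature.Probability.RandomPlanarGeometry.HullApproximation
import Literature.Probability.RandomPlanarGeometry.ConformalRestrictionProofs
import Literature.Probability.RandomPlanarGeometry.ConformalMapCaratheodoryProofs
import Literature.Topology.PlaneTopology.EilenbergCriterion
import HarnessLib.Audit

/-!
# Line `chart-scale` — crux `ConfCovLimit` (stmt-CriticalPhenomena-0771), route SAWConfRestriction (r2)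
# (shared verbatim with SAWTowerCount r6, SAWBrownianDomination r4) — strategist's ALTERNATIVE to `birth`

Crux BY NAME: `Summit.CriticalPhenomena.SAWScalingLimit.Theses.SAWConfRestriction.ConfCovLimit` —
`∃ P, P.IsChordal ∧ (lim: full scaling limit of the critical δℤ² SAW, every Dobrushin domain, every
endpoint approximation) ∧ (conf: P D' = Φ_* (P D) for EVERY conformal g : D → D' respecting the marks)`.

**Idea (the minimal conformal input, via LSW in every chart and mixing).**  The live line `birth`
isolates the whole (conf) clause in one stub (`stub_confCovOfLimit`: covariance of the limit under ALL
conformal maps between ALL pairs of domains).  But after what the tree PROVES —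
(i) lattice-similarity covariance of every scaling-limit family (`LatticeSimilarityOfLimit.cov_similarity`),
(ii) the Lawler–Schramm–Werner pipeline (`exists_isRestrictionMeasure_of_isHullMultiplicative_holds`,
`eq_five_eighths_of_outer_simple_holds`, `RestrictionUniqueness`), in which conformal covariance is
consumed in exactly two places: SCALE INVARIANCE OF EACH CHART LAW (= invariance of `P D` under the
one-parameter group `Aut(D; a, b)`) and TRANSPORT to hull subdomains, and (iii) the mixing reduction of
the sibling line `Cruxes/RStarRot/Lines/scale_mixing.lean` (transport ⟸ internal scale invariance at
`D` and `D_J` + a 0–1 law for the germ of the trace at `a`) — the conformal input the identification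
actually needs from the SAW limit is only

  (A) INTERNAL SCALE INVARIANCE: each `P D` is invariant under `Aut(D; a, b)` (the "Möbius step"), and
  (G) GERM TRIVIALITY: the germ σ-field of the trace at `a` is `P D`-trivial,

given hull restriction and simplicity of the limit (the route's own r4/r5, in the weak forms LSW
consumes).  Then every chart law is `P_{5/8}`, every `P D` is the chordal SLE_{8/3} law, and FULL
conformal covariance — rotations by generic angles included — is a COROLLARY (no rotation is ever
compared on the lattice: isotropy of the `ℤ²` SAW limit follows from (A)+(G)+restriction+simplicity).

Stubs (7 = 3 verbatim/near-verbatim items + 2 OPEN new + 2 provable-now shared with `RStarRot/scale_mixing`):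
* `stub_limitExists` — VERBATIM item stmt-1371 `LimitExists` (existence; own chain, 8 routes).
* `stub_hullRestrictionOfLimit` — every scaling-limit family has two-sided restriction over HULL
  subdomains (`IsHullRestriction`: `D ∖ D'` away from `a, b` — the paper's hypothesis); implied by item
  stmt-0773 `RestrictionOfLimit` through `IsRestriction.isHullRestriction` (`hullRestriction_of_item0773`
  below) and free of 0773's pinched-subdomain flag.
* `stub_simpleOfLimit` — VERBATIM item stmt-0774 `SimpleOfLimit` (conclusion ≡ `IsCarriedBySimpleCurves`).
* `stub_internalScaleInvarianceOfLimit` (OPEN, hardest) — (A) for the SAW limit.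
* `stub_germZeroOneOfLimit` (OPEN) — (G) for the SAW limit.
* `stub_chartMultiplicative`, `stub_chartRigidity` — VERBATIM stubs 3–4 of `RStarRot/Lines/scale_mixing.lean`
  (generic in `P`; provable now from the tree per that line card; ONE proof lands them for both cruxes).

`ConfCovLimit_of` concludes the crux BY NAME from the seven `Registered.stub_*` statements (real proof);
`confCovOfLimit_of_chart` concludes the COVARIANCE CHILD of the strategist's split (`∀ P, chordal → (lim)
→ IsConformallyCovariant`) from stubs 2–7.  Sorries: exactly 7 = the stubs; zero elsewhere.
NOT registered with `ledger skeleton check` (that would overwrite the live `birth` registration — the CLI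
has no `--alt`); published as a crux workfile + evidence.
-/

noncomputable section

open MeasureTheory Filter Topology Set Metric
open Literature.Probability.RandomPlanarGeometry Literature.Probability.RandomPlanarGeometry.SAW
open Literature.Probability.LatticeModels
open scoped ENNReal NNReal

namespace Summit.CriticalPhenomena.SAWScalingLimit.Cruxes.ConfCovLimit.ChartScale

/-! ## The stubs -/

/-- **stub (E) — EXISTENCE of the full scaling limit** (VERBATIM item stmt-CriticalPhenomena-1371
`SAWRestrictionRigidity.LimitExists` = child 1 of the strategist's split of this crux). OPEN (tightness
+ uniqueness of subsequential limits; leaf census `limitExists_of_leaves_bounded`: stmt-18042 ∧ 17587 ∧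
SequentialSlitAvoidance ∧ 10649). -/
theorem stub_limitExists : ∃ P : Literature.Probability.RandomPlanarGeometry.ChordalFamily, P.IsChordal ∧ (∀ (D : Literature.Probability.RandomPlanarGeometry.DobrushinDomain) (a b : ℝ → Literature.Probability.LatticeModels.Site 2), Literature.Probability.RandomPlanarGeometry.SAW.IsEndpointApprox D a b → Literature.Probability.RandomPlanarGeometry.TendstoLaw (fun δ (γ : Literature.Probability.RandomPlanarGeometry.SAW.DomainSAW D.carrier δ (a δ) (b δ)) => γ.curve) (fun δ => Literature.Probability.RandomPlanarGeometry.SAW.law D.carrier δ (a δ) (b δ)) id (P D)) := by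
  sorry

/-- **stub (HR) — HULL RESTRICTION OF THE LIMIT**: every chordal full scaling limit of the critical SAW
laws has the two-sided restriction property over hull subdomains (`ChordalFamily.IsHullRestriction`,
LSW03's `𝒜₁`-covariance transposed: `P D'(T)·P D(range ⊆ cl D') = P D(T ∩ {range ⊆ cl D'})` for
`D'` a hull subdomain of `D`). At lattice level an identity (LSW04 §3.4.5); content = portmanteau on
the closed event + null touching. Implied by item stmt-0773 (`hullRestriction_of_item0773`). -/
theorem stub_hullRestrictionOfLimit : ∀ P : Literature.Probability.RandomPlanarGeometry.ChordalFamily, P.IsChordal → (∀ (D : Literature.Probability.RandomPlanarGeometry.DobrushinDomain) (a b : ℝ → Literature.Probability.LatticeModels.Site 2), Literature.Probability.RandomPlanarGeometry.SAW.IsEndpointApprox D a b → Literature.Probability.RandomPlanarGeometry.TendstoLaw (fun δ (γ : Literature.Probability.RandomPlanarGeometry.SAW.DomainSAW D.carrier δ (a δ) (b δ)) => γ.curve) (fun δ => Literature.Probability.RandomPlanarGeometry.SAW.law D.carrier δ (a δ) (b δ)) id (P D)) → P.IsHullRestriction := by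
  sorry

/-- **stub (S) — SIMPLICITY OF THE LIMIT** (VERBATIM item stmt-CriticalPhenomena-0774 `SimpleOfLimit`,
r5 of this route): every chordal full scaling limit is carried by simple curves meeting `∂D` only at
the marked points (≡ `ChordalFamily.IsCarriedBySimpleCurves`). OPEN (no-macroscopic-self-touching /
no-boundary-crawling bounds for the `x_c`-SAW). -/
theorem stub_simpleOfLimit : ∀ P : Literature.Probability.RandomPlanarGeometry.ChordalFamily, P.IsChordal → (∀ (D : Literature.Probability.RandomPlanarGeometry.DobrushinDomain) (a b : ℝ → Literature.Probability.LatticeModels.Site 2), Literature.Probability.RandomPlanarGeometry.SAW.IsEndpointApprox D a b → Literature.Probability.RandomPlanarGeometry.TendstoLaw (fun δ (γ : Literature.Probability.RandomPlanarGeometry.SAW.DomainSAW D.carrier δ (a δ) (b δ)) => γ.curve) (fun δ => Literature.Probability.RandomPlanarGeometry.SAW.law D.carrier δ (a δ) (b δ)) id (P D)) → ∀ D : Literature.Probability.RandomPlanarGeometry.DobrushinDomain, ∀ᵐ γ ∂(P D), γ ∈ Literature.Probability.RandomPlanarGeometry.CurveClass.simple ∧ γ.range ∩ frontier D.carrier ⊆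 {D.pt 0, D.pt 1} := by
  sorry

/-- **stub (A) — INTERNAL SCALE INVARIANCE OF THE LIMIT** (OPEN, hardest; the Möbius step): every
chordal full scaling limit `P` of the critical `δℤ²` SAW laws is, in EACH Dobrushin domain separately,
invariant under every conformal automorphism `g` of `D` fixing the marked points (boundary values
`a ↦ a`, `b ↦ b`), pushed along any continuous plane map `Φ` agreeing with `g` on `D`:
`P D = Φ_* (P D)`. In a half-plane chart this is DILATION invariance of the pull-back law. It is the
crux's (conf) clause specialised to `D' = D` (so NECESSARY), and by this line it is — together with (G)
— SUFFICIENT. No rotation, no second domain, no second lattice appears; but `Aut(D;a,b)` is non-affine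
for every bounded `D` (an affine self-map of a bounded domain fixing two boundary points is the
identity), so nothing is inherited from lattice symmetries: this is the irreducible conformal content. -/
theorem stub_internalScaleInvarianceOfLimit : ∀ P : Literature.Probability.RandomPlanarGeometry.ChordalFamily, P.IsChordal → (∀ (D : Literature.Probability.RandomPlanarGeometry.DobrushinDomain) (a b : ℝ → Literature.Probability.LatticeModels.Site 2), Literature.Probability.RandomPlanarGeometry.SAW.IsEndpointApprox D a b → Literature.Probability.RandomPlanarGeometry.TendstoLaw (fun δ (γ : Literature.Probability.RandomPlanarGeometry.SAW.DomainSAW D.carrier δ (a δ) (b δ)) => γ.curve) (fun δ => Literature.Probability.RandomPlanarGeometry.SAW.law D.carrier δ (a δ) (b δ)) id (P D)) → ∀ (D : Literature.Probability.RandomPlanarGeometry.DobrushinDomain) (g : Literature.Probability.RandomPlanarGeometry.ConformalEquiv D.carrier D.carrier) (Φ : C(ℂ, ℂ)), g.HasBoundaryValue (D.pt 0) (D.pt 0) → g.HasBoundaryValue (D.pt 1) (D.pt 1) → Set.EqOn Φ g D.carrier → P D = (P D).map (Literature.Probability.RandomPlanarGeometry.CurveClass.map Φ) := by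
  sorry

/-- **stub (G) — GERM 0–1 LAW OF THE LIMIT** (OPEN): for every chordal full scaling limit `P` and every
Dobrushin domain `(D; a, b)`, every event of the GERM σ-FIELD of the trace at `a` — `⨅ ε>0` of the
σ-fields generated by "the trace avoids `F`", `F` closed `⊆ closedBall a ε` — has `P D`-probability `0`
or `1`. Necessary for the conjunct (SLE_{8/3}: Blumenthal for the driving Brownian motion + transience of
a simple trace). SAW mechanism: the macroscopic walk forgets its germ — by Bayes, germ–bulk independence
is "the local limit at the start is insensitive to conditioning on macroscopic events", which the
Kesten irreducible-bridge renewal structure delivers wherever renewal (bridge) scales are dense between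
the germ scale and the macroscopic scale (half-plane / flat-boundary starts; Alberts–Duminil-Copin's
bridge decomposition of restriction measures is its continuum shadow). -/
theorem stub_germZeroOneOfLimit : ∀ P : Literature.Probability.RandomPlanarGeometry.ChordalFamily, P.IsChordal → (∀ (D : Literature.Probability.RandomPlanarGeometry.DobrushinDomain) (a b : ℝ → Literature.Probability.LatticeModels.Site 2), Literature.Probability.RandomPlanarGeometry.SAW.IsEndpointApprox D a b → Literature.Probability.RandomPlanarGeometry.TendstoLaw (fun δ (γ : Literature.Probability.RandomPlanarGeometry.SAW.DomainSAW D.carrier δ (a δ) (b δ)) => γ.curve) (fun δ => Literature.Probability.RandomPlanarGeometry.SAW.law D.carrier δ (a δ) (b δ)) id (P D)) → ∀ (D : Literature.Probability.RandomPlanarGeometry.DobrushinDomain) (S : Set (Literature.Probability.RandomPlanarGeometry.CurveClass ℂ)), @MeasurableSet (Literature.Probability.RandomPlanarGeometry.CurveClass ℂ) (⨅ (ε : ℝ) (_ : 0 < ε), MeasurableSpace.generateFrom {T : Set (Literature.Probability.RandomPlanarGeometry.CurveClass ℂ) | ∃ F : Set ℂ, IsClosed F ∧ F ⊆ Metric.closedBall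 (D.pt 0) ε ∧ T = Literature.Probability.RandomPlanarGeometry.CurveClass.rangeSubset Fᶜ}) S → P D S = 0 ∨ P D S = 1 := by
  sorry

/-- **stub (M) — CHART MULTIPLICATIVITY** (provable now, size L; VERBATIM `stub_chartMultiplicative` of
`Cruxes/RStarRot/Lines/scale_mixing.lean`, generic in `P`): chordal + hull restriction + simple carriers +
internal scale invariance + germ 0–1 ⇒ every pull-back law is scale invariant and arc-hull
multiplicative (the mixing argument; inputs in `RestrictionPullback` / `RestrictionCovariance` /
`HullApproximation`). -/
theorem stub_chartMultiplicative : ∀ P : Literature.Probability.RandomPlanarGeometry.ChordalFamily, P.IsChordal → P.IsHullRestriction → P.IsCarriedBySimpleCurves → (∀ (D : Literature.Probability.RandomPlanarGeometry.DobrushinDomain) (g : Literature.Probability.RandomPlanarGeometry.ConformalEquiv D.carrier D.carrier) (Φ : C(ℂ, ℂ)), g.HasBoundaryValue (D.pt 0) (D.pt 0) → g.HasBoundaryValue (D.pt 1) (D.pt 1) → Set.EqOn Φ g D.carrier → P D = (P D).map (Literature.Probability.RandomPlanarGeometry.CurveClass.map Φ)) → (∀ (D : Literature.Probability.RandomPlanarGeometry.DobrushinDomain)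 (S : Set (Literature.Probability.RandomPlanarGeometry.CurveClass ℂ)), @MeasurableSet (Literature.Probability.RandomPlanarGeometry.CurveClass ℂ) (⨅ (ε : ℝ) (_ : 0 < ε), MeasurableSpace.generateFrom {T : Set (Literature.Probability.RandomPlanarGeometry.CurveClass ℂ) | ∃ F : Set ℂ, IsClosed F ∧ F ⊆ Metric.closedBall (D.pt 0) ε ∧ T = Literature.Probability.RandomPlanarGeometry.CurveClass.rangeSubset Fᶜ}) S → P D S = 0 ∨ P D S = 1) → ∀ (D : Literature.Probability.RandomPlanarGeometry.DobrushinDomain) (φ : Literature.Probability.RandomPlanarGeometry.ConformalEquiv UpperHalfPlane.upperHalfPlaneSet D.carrier) (hφ : D.IsChordalUniformizing φ), Literature.Probability.RandomPlanarGeometry.RestrictionConfig.IsScaleInvariant (Literature.Probability.RandomPlanarGeometry.ChordalFamily.pullbackLaw P D φ Literature.Topology.PlaneTopology.JordanArcSeparation_holds Literature.Probability.RandomPlanarGeometry.JordanDomain.exists_continuousOn_extension_holds hφ) ∧ Literature.Probability.RandomPlanarGeometry.RestrictionConfig.IsArcHullMultiplicative (Literature.Probability.RandomPlanarGeometry.ChordalFamily.pullbackLaw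 P D φ Literature.Topology.PlaneTopology.JordanArcSeparation_holds Literature.Probability.RandomPlanarGeometry.JordanDomain.exists_continuousOn_extension_holds hφ) := by
  sorry

/-- **stub (R) — CHART RIGIDITY** (provable now from the tree, size M–L; VERBATIM `stub_chartRigidity` of
`Cruxes/RStarRot/Lines/scale_mixing.lean`): chordal + hull restriction + simple carriers + (scale invariant
∧ arc-hull multiplicative pull-back laws) ⇒ `IsConformallyCovariant` (Prop. 3.3 ⇒ `P_α`; simple ⇒
`α = 5/8`; uniqueness of `P_{5/8}`; transport back along `exists_continuousMap_conj`). -/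
theorem stub_chartRigidity : ∀ P : Literature.Probability.RandomPlanarGeometry.ChordalFamily, P.IsChordal → P.IsHullRestriction → P.IsCarriedBySimpleCurves → (∀ (D : Literature.Probability.RandomPlanarGeometry.DobrushinDomain) (φ : Literature.Probability.RandomPlanarGeometry.ConformalEquiv UpperHalfPlane.upperHalfPlaneSet D.carrier) (hφ : D.IsChordalUniformizing φ), Literature.Probability.RandomPlanarGeometry.RestrictionConfig.IsScaleInvariant (Literature.Probability.RandomPlanarGeometry.ChordalFamily.pullbackLaw P D φ Literature.Topology.PlaneTopology.JordanArcSeparation_holds Literature.Probability.RandomPlanarGeometry.JordanDomain.exists_continuousOn_extension_holds hφ) ∧ Literature.Probability.RandomPlanarGeometry.RestrictionConfig.IsArcHullMultiplicative (Literature.Probability.RandomPlanarGeometry.ChordalFamily.pullbackLaw P D φ Literature.Topology.PlaneTopology.JordanArcSeparation_holds Literature.Probability.RandomPlanarGeometry.JordanDomain.exists_continuousOn_extension_holds hφ)) → P.IsConformallyCovariant := by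
  sorry

/-! ## Name-keyed aliases of the stub statements (skeleton-check convention) -/

namespace Registered

/-- (E) ≡ item stmt-1371. -/
abbrev stub_limitExists : Prop :=
  ∃ P : Literature.Probability.RandomPlanarGeometry.ChordalFamily, P.IsChordal ∧ (∀ (D : Literature.Probability.RandomPlanarGeometry.DobrushinDomain) (a b : ℝ → Literature.Probability.LatticeModels.Site 2), Literature.Probability.RandomPlanarGeometry.SAW.IsEndpointApprox D a b → Literature.Probability.RandomPlanarGeometry.TendstoLaw (fun δ (γ : Literature.Probability.RandomPlanarGeometry.SAW.DomainSAW D.carrier δ (a δ) (b δ)) => γ.curve) (fun δ => Literature.Probability.RandomPlanarGeometry.SAW.law D.carrier δ (a δ) (b δ)) id (P D))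

/-- (HR). -/
abbrev stub_hullRestrictionOfLimit : Prop :=
  ∀ P : Literature.Probability.RandomPlanarGeometry.ChordalFamily, P.IsChordal → (∀ (D : Literature.Probability.RandomPlanarGeometry.DobrushinDomain) (a b : ℝ → Literature.Probability.LatticeModels.Site 2), Literature.Probability.RandomPlanarGeometry.SAW.IsEndpointApprox D a b → Literature.Probability.RandomPlanarGeometry.TendstoLaw (fun δ (γ : Literature.Probability.RandomPlanarGeometry.SAW.DomainSAW D.carrier δ (a δ) (b δ)) => γ.curve) (fun δ => Literature.Probability.RandomPlanarGeometry.SAW.law D.carrier δ (a δ) (b δ)) id (P D)) → P.IsHullRestriction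

/-- (S) ≡ item stmt-0774. -/
abbrev stub_simpleOfLimit : Prop :=
  ∀ P : Literature.Probability.RandomPlanarGeometry.ChordalFamily, P.IsChordal → (∀ (D : Literature.Probability.RandomPlanarGeometry.DobrushinDomain) (a b : ℝ → Literature.Probability.LatticeModels.Site 2), Literature.Probability.RandomPlanarGeometry.SAW.IsEndpointApprox D a b → Literature.Probability.RandomPlanarGeometry.TendstoLaw (fun δ (γ : Literature.Probability.RandomPlanarGeometry.SAW.DomainSAW D.carrier δ (a δ) (b δ)) => γ.curve) (fun δ => Literature.Probability.RandomPlanarGeometry.SAW.law D.carrier δ (a δ) (b δ)) id (P D)) → ∀ D : Literature.Probability.RandomPlanarGeometry.DobrushinDomain, ∀ᵐ γ ∂(P D), γ ∈ Literature.Probability.RandomPlanarGeometry.CurveClass.simple ∧ γ.range ∩ frontier D.carrier ⊆ {D.pt 0, D.pt 1}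

/-- (A). -/
abbrev stub_internalScaleInvarianceOfLimit : Prop :=
  ∀ P : Literature.Probability.RandomPlanarGeometry.ChordalFamily, P.IsChordal → (∀ (D : Literature.Probability.RandomPlanarGeometry.DobrushinDomain) (a b : ℝ → Literature.Probability.LatticeModels.Site 2), Literature.Probability.RandomPlanarGeometry.SAW.IsEndpointApprox D a b → Literature.Probability.RandomPlanarGeometry.TendstoLaw (fun δ (γ : Literature.Probability.RandomPlanarGeometry.SAW.DomainSAW D.carrier δ (a δ) (b δ)) => γ.curve) (fun δ => Literature.Probability.RandomPlanarGeometry.SAW.law D.carrier δ (a δ) (b δ)) id (P D)) → ∀ (D : Literature.Probability.RandomPlanarGeometry.DobrushinDomain) (g : Literature.Probability.RandomPlanarGeometry.ConformalEquiv D.carrier D.carrier) (Φ : C(ℂ, ℂ)), g.HasBoundaryValue (D.pt 0) (D.pt 0) → g.HasBoundaryValue (D.pt 1) (D.pt 1) → Set.EqOn Φ g D.carrier → P D = (P D).map (Literature.Probability.RandomPlanarGeometry.CurveClass.map Φ)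

/-- (G). -/
abbrev stub_germZeroOneOfLimit : Prop :=
  ∀ P : Literature.Probability.RandomPlanarGeometry.ChordalFamily, P.IsChordal → (∀ (D : Literature.Probability.RandomPlanarGeometry.DobrushinDomain) (a b : ℝ → Literature.Probability.LatticeModels.Site 2), Literature.Probability.RandomPlanarGeometry.SAW.IsEndpointApprox D a b → Literature.Probability.RandomPlanarGeometry.TendstoLaw (fun δ (γ : Literature.Probability.RandomPlanarGeometry.SAW.DomainSAW D.carrier δ (a δ) (b δ)) => γ.curve) (fun δ => Literature.Probability.RandomPlanarGeometry.SAW.law D.carrier δ (a δ) (b δ)) id (P D)) → ∀ (D : Literature.Probability.RandomPlanarGeometry.DobrushinDomain) (S : Set (Literature.Probability.RandomPlanarGeometry.CurveClass ℂ)), @MeasurableSet (Literature.Probability.RandomPlanarGeometry.CurveClass ℂ) (⨅ (ε : ℝ) (_ : 0 < ε), MeasurableSpace.generateFrom {T : Set (Literature.Probability.RandomPlanarGeometry.CurveClass ℂ) | ∃ F : Set ℂ, IsClosed F ∧ F ⊆ Metric.closedBall (D.pt 0) ε ∧ T = Literature.Probability.RandomPlanarGeometry.CurveClass.rangeSubset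 Fᶜ}) S → P D S = 0 ∨ P D S = 1

/-- (M) ≡ scale_mixing stub 3. -/
abbrev stub_chartMultiplicative : Prop :=
  ∀ P : Literature.Probability.RandomPlanarGeometry.ChordalFamily, P.IsChordal → P.IsHullRestriction → P.IsCarriedBySimpleCurves → (∀ (D : Literature.Probability.RandomPlanarGeometry.DobrushinDomain) (g : Literature.Probability.RandomPlanarGeometry.ConformalEquiv D.carrier D.carrier) (Φ : C(ℂ, ℂ)), g.HasBoundaryValue (D.pt 0) (D.pt 0) → g.HasBoundaryValue (D.pt 1) (D.pt 1) → Set.EqOn Φ g D.carrier → P D = (P D).map (Literature.Probability.RandomPlanarGeometry.CurveClass.map Φ)) → (∀ (D : Literature.Probability.RandomPlanarGeometry.DobrushinDomain) (S : Set (Literature.Probability.RandomPlanarGeometry.CurveClass ℂ)), @MeasurableSet (Literature.Probability.RandomPlanarGeometry.CurveClass ℂ) (⨅ (ε : ℝ) (_ : 0 < ε), MeasurableSpace.generateFrom {T : Set (Literature.Probability.RandomPlanarGeometry.CurveClass ℂ) | ∃ F : Set ℂ, IsClosed F ∧ F ⊆ Metric.closedBall (D.pt 0) ε ∧ T = Literature.Probability.RandomPlanarGeometry.CurveClass.rangeSubset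 Fᶜ}) S → P D S = 0 ∨ P D S = 1) → ∀ (D : Literature.Probability.RandomPlanarGeometry.DobrushinDomain) (φ : Literature.Probability.RandomPlanarGeometry.ConformalEquiv UpperHalfPlane.upperHalfPlaneSet D.carrier) (hφ : D.IsChordalUniformizing φ), Literature.Probability.RandomPlanarGeometry.RestrictionConfig.IsScaleInvariant (Literature.Probability.RandomPlanarGeometry.ChordalFamily.pullbackLaw P D φ Literature.Topology.PlaneTopology.JordanArcSeparation_holds Literature.Probability.RandomPlanarGeometry.JordanDomain.exists_continuousOn_extension_holds hφ) ∧ Literature.Probability.RandomPlanarGeometry.RestrictionConfig.IsArcHullMultiplicative (Literature.Probability.RandomPlanarGeometry.ChordalFamily.pullbackLaw P D φ Literature.Topology.PlaneTopology.JordanArcSeparation_holds Literature.Probability.RandomPlanarGeometry.JordanDomain.exists_continuousOn_extension_holds hφ)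

/-- (R) ≡ scale_mixing stub 4. -/
abbrev stub_chartRigidity : Prop :=
  ∀ P : Literature.Probability.RandomPlanarGeometry.ChordalFamily, P.IsChordal → P.IsHullRestriction → P.IsCarriedBySimpleCurves → (∀ (D : Literature.Probability.RandomPlanarGeometry.DobrushinDomain) (φ : Literature.Probability.RandomPlanarGeometry.ConformalEquiv UpperHalfPlane.upperHalfPlaneSet D.carrier) (hφ : D.IsChordalUniformizing φ), Literature.Probability.RandomPlanarGeometry.RestrictionConfig.IsScaleInvariant (Literature.Probability.RandomPlanarGeometry.ChordalFamily.pullbackLaw P D φ Literature.Topology.PlaneTopology.JordanArcSeparation_holds Literature.Probability.RandomPlanarGeometry.JordanDomain.exists_continuousOn_extension_holds hφ) ∧ Literature.Probability.RandomPlanarGeometry.RestrictionConfig.IsArcHullMultiplicative (Literature.Probability.RandomPlanarGeometry.ChordalFamily.pullbackLaw P D φ Literature.Topology.PlaneTopology.JordanArcSeparation_holds Literature.Probability.RandomPlanarGeometry.JordanDomain.exists_continuousOn_extension_holds hφ)) → P.IsConformallyCovariant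

end Registered

/-! ## The compositions (PROVED, no sorry of their own) -/

/-- **Conformal covariance OF the limit from (HR), (S), (A), (G), (M), (R)** — concludes CHILD 2 of the
strategist's split (`ConfCovOfLimit`: every chordal full scaling limit is conformally covariant), hence
also the registered stub `stub_confCovOfLimit` of line `birth` (identical statement). -/
theorem confCovOfLimit_of_chart (hHR : Registered.stub_hullRestrictionOfLimit)
    (hS : Registered.stub_simpleOfLimit) (hA : Registered.stub_internalScaleInvarianceOfLimit)
    (hG : Registered.stub_germZeroOneOfLimit) (hM : Registered.stub_chartMultiplicative)
    (hR : Registered.stub_chartRigidity) :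
    ∀ P : Literature.Probability.RandomPlanarGeometry.ChordalFamily, P.IsChordal → (∀ (D : Literature.Probability.RandomPlanarGeometry.DobrushinDomain) (a b : ℝ → Literature.Probability.LatticeModels.Site 2), Literature.Probability.RandomPlanarGeometry.SAW.IsEndpointApprox D a b → Literature.Probability.RandomPlanarGeometry.TendstoLaw (fun δ (γ : Literature.Probability.RandomPlanarGeometry.SAW.DomainSAW D.carrier δ (a δ) (b δ)) => γ.curve) (fun δ => Literature.Probability.RandomPlanarGeometry.SAW.law D.carrier δ (a δ) (b δ)) id (P D)) → P.IsConformallyCovariant := by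
  intro P hch hlim
  have hres : P.IsHullRestriction := hHR P hch hlim
  have hsimple : P.IsCarriedBySimpleCurves := hS P hch hlim
  exact hR P hch hres hsimple (hM P hch hres hsimple (hA P hch hlim) (hG P hch hlim))

/-- **`ConfCovLimit` BY NAME from the seven stubs**: `P` from (E); covariance of `P` from
`confCovOfLimit_of_chart`; unbundle with `ChordalFamily.isConformallyCovariant_iff` (`Iff.rfl`).
[cite: LawlerSchrammWerner2003Restriction, Prop. 3.3 and p. 5 result 2] -/
theorem ConfCovLimit_of (hE : Registered.stub_limitExists) (hHR : Registered.stub_hullRestrictionOfLimit)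
    (hS : Registered.stub_simpleOfLimit) (hA : Registered.stub_internalScaleInvarianceOfLimit)
    (hG : Registered.stub_germZeroOneOfLimit) (hM : Registered.stub_chartMultiplicative)
    (hR : Registered.stub_chartRigidity) :
    Summit.CriticalPhenomena.SAWScalingLimit.Theses.SAWConfRestriction.ConfCovLimit := by
  obtain ⟨P, hch, hlim⟩ := hE
  exact ⟨P, hch, hlim, (ChordalFamily.isConformallyCovariant_iff P).1
    (confCovOfLimit_of_chart hHR hS hA hG hM hR P hch hlim)⟩

/-- Wiring check: the crux BY NAME from the seven (sorried) stub theorems — inherits their `sorry`,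
claims nothing. -/
theorem ConfCovLimit_wiring :
    Summit.CriticalPhenomena.SAWScalingLimit.Theses.SAWConfRestriction.ConfCovLimit :=
  ConfCovLimit_of stub_limitExists stub_hullRestrictionOfLimit stub_simpleOfLimit
    stub_internalScaleInvarianceOfLimit stub_germZeroOneOfLimit stub_chartMultiplicative
    stub_chartRigidity

/-! ## Pins (documentation) -/

/-- (HR) is implied by the route's own r4 `RestrictionOfLimit` (stmt-0773; all Jordan subdomains) via
`IsRestriction.isHullRestriction`. [folklore] -/
theorem hullRestriction_of_item0773
    (h : Summit.CriticalPhenomena.SAWScalingLimit.Theses.SAWConfRestriction.RestrictionOfLimit) :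
    Registered.stub_hullRestrictionOfLimit :=
  fun P hch hlim => ((ChordalFamily.isRestriction_iff P).2 (h P hch hlim)).isHullRestriction

/-- (S) IS the route's r5 `SimpleOfLimit` (stmt-0774). -/
theorem stub_simpleOfLimit_iff_item0774 :
    Registered.stub_simpleOfLimit ↔
      Summit.CriticalPhenomena.SAWScalingLimit.Theses.SAWConfRestriction.SimpleOfLimit :=
  Iff.rfl

/-- (A) is NECESSARY: it is the crux's (conf) clause at `D' = D` (from any family-level covariance of
the limit: `IsConformallyCovariant → (A)-conclusion`). [folklore] -/
theorem internalScaleInvariance_of_isConformallyCovariant {P : ChordalFamily}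
    (h : P.IsConformallyCovariant) (D : DobrushinDomain) (g : ConformalEquiv D.carrier D.carrier)
    (Φ : C(ℂ, ℂ)) (h0 : g.HasBoundaryValue (D.pt 0) (D.pt 0)) (h1 : g.HasBoundaryValue (D.pt 1) (D.pt 1))
    (hΦ : Set.EqOn Φ g D.carrier) : P D = (P D).map (CurveClass.map Φ) :=
  h D D g Φ h0 h1 hΦ

/-- (E) in bundled form. [folklore] -/
theorem stub_limitExists_iff_family :
    Registered.stub_limitExists ↔ ∃ P : ChordalFamily, SAW.IsScalingLimitFamily P :=
  ⟨fun ⟨P, h1, h2⟩ => ⟨P, ⟨h1, h2⟩⟩, fun ⟨P, ⟨h1, h2⟩⟩ => ⟨P, h1, h2⟩⟩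

end Summit.CriticalPhenomena.SAWScalingLimit.Cruxes.ConfCovLimit.ChartScale

end
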